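import Summits.Ventures.PercRepro.RankLevelSetCoreSharper
import Summits.Ventures.PercRepro.RankLevelSetPlaneSix

/-!
# PercRepro — THEOREM C∞ on the core with an ARBITRARY flat bound (night-1, gen 3)

`proofs/NIGHT-1-C025-induction.md` §14.19. The counts of `RankLevelSetCoreSharper` used the flat bound `2^q − 1`; here
the bound is a parameter `B` («every set of rank `≤ q` has `≤ B` points»), so that every sharper flat bound of the
cell (the cover recursion's `7·2^{q−3} − 1`, C-030's `C(q+1, 2)` when it lands) feeds the thresholds directly:

* **`ncard_eRk_eq_le_choose_mul_of_bound`**, **`ncard_eRk_le_le_sum_choose_mul_of_bound`** — `#{r = q} ≤ C(n,q)·2^{B−q}`,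
  `#{r ≤ q} ≤ (Σ_{j≤q} C(n,j))·2^{B−q}` (for ANY finite matroid with those flat bounds — no `e`-free hypothesis);
* **`core_all_corank_of_thresholds_of_bound`** — the core theorem with `K = 2^{B − q}`: corank `> 2q + (B − q)`,
  regime thresholds `8(q+1)·K·n^q ≤ 2^n` (`n ≥ N₁`) and `2^{p+q}·K·(2a+1) ≤ 4^a` (`p ≥ P₂`, `a = p − 1 − q`);
* **`c025_core_four_sharpest`** (`B = 13`: `p ≥ 35`, `|E| ≥ p + 20`), **`c025_core_five_sharpest`** (`B = 27`: `p ≥ 57`,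
  `|E| ≥ p + 35`) — with the cover-recursion bounds of `RankLevelSetPlaneSix`.
Axioms: standard.
-/

open scoped Matroid

namespace PercRepro

namespace ThmN

open Set

variable {α : Type}

/-- **The rank-`q` count with an arbitrary flat bound**: if every set of rank `≤ q` has `≤ B` points (`q ≤ B`), then
`#{X ⊆ E : r(X) = q} ≤ C(n, q) · 2^{B − q}`. -/
theorem ncard_eRk_eq_le_choose_mul_of_bound (M : Matroid α) [M.Finite]
    (q B : ℕ) (hB : ∀ X ⊆ M.E, M.eRk X ≤ q → X.ncard ≤ B) :
    {X : Set α | X ⊆ M.E ∧ M.eRk X = q}.ncard ≤ M.ground_finite.toFinset.card.choose q * 2 ^ (B - q) := by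
  classical
  set Ef := M.ground_finite.toFinset with hEf
  have hE : (Ef : Set α) = M.E := Set.Finite.coe_toFinset _
  set S := {X : Set α | X ⊆ M.E ∧ M.eRk X = q} with hS
  have hclfin : ∀ s : Finset α, (M.closure (s : Set α) \ (s : Set α)).Finite :=
    fun s => (M.ground_finite.subset (M.closure_subset_ground _)).subset Set.sdiff_subset
  set Tf : Finset (Finset α × Set α) := (Ef.powersetCard q).biUnion (fun s =>
    ((hclfin s).toFinset.powerset.image (fun t : Finset α => (t : Set α))).image
      (fun Z => (s, (s : Set α) ∪ Z))) with hTf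
  have hex : ∀ X ∈ S, ∃ s : Finset α, (s, X) ∈ Tf := by
    intro X hX
    obtain ⟨I, hI⟩ := M.exists_isBasis X hX.1
    have hIfin : I.Finite := M.ground_finite.subset (hI.subset.trans hX.1)
    have hIcard : I.ncard = q := by
      have h := hI.encard_eq_eRk
      rw [hX.2, ← hIfin.cast_ncard_eq] at h
      exact_mod_cast h
    refine ⟨hIfin.toFinset, ?_⟩
    rw [hTf, Finset.mem_biUnion]
    refine ⟨hIfin.toFinset, ?_, ?_⟩
    · rw [Finset.mem_powersetCard]
      refine ⟨?_, ?_⟩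
      · intro x hx
        rw [Set.Finite.mem_toFinset] at hx
        rw [hEf, Set.Finite.mem_toFinset]
        exact hX.1 (hI.subset hx)
      · rw [← Set.ncard_eq_toFinset_card I hIfin]; exact hIcard
    · rw [Finset.mem_image]
      refine ⟨X \ I, ?_, ?_⟩
      · apply Matroid.mem_powersetSets
        rw [Set.Finite.coe_toFinset]
        exact Set.sdiff_subset_sdiff_left hI.subset_closure
      · rw [Set.Finite.coe_toFinset, Set.union_sdiff_cancel hI.subset]
  let g : Set α → Finset α × Set α := fun X =>
    if h : X ∈ S then (Classical.choose (hex X h), X) else (∅, X)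
  have hgmaps : ∀ X ∈ S, g X ∈ (Tf : Set (Finset α × Set α)) := by
    intro X hX
    simp only [g, dif_pos hX]
    exact Classical.choose_spec (hex X hX)
  have hginj : Set.InjOn g S := by
    intro X hX Y hY hXY
    simp only [g, dif_pos hX, dif_pos hY, Prod.mk.injEq] at hXY
    exact hXY.2
  have hS : S.ncard ≤ Tf.card := by
    rw [← Set.ncard_coe_finset]
    exact Set.ncard_le_ncard_of_injOn g hgmaps hginj (Tf.finite_toSet)
  have hTfcard : Tf.card ≤ Ef.card.choose q * 2 ^ (B - q) := by
    calc Tf.card ≤ ∑ s ∈ Ef.powersetCard q,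
          (((hclfin s).toFinset.powerset.image (fun t : Finset α => (t : Set α))).image
            (fun Z => (s, (s : Set α) ∪ Z))).card := Finset.card_biUnion_le
      _ ≤ ∑ s ∈ Ef.powersetCard q, 2 ^ (B - q) := by
          apply Finset.sum_le_sum
          intro s hs
          rw [Finset.mem_powersetCard] at hs
          calc (((hclfin s).toFinset.powerset.image (fun t : Finset α => (t : Set α))).image
                (fun Z => (s, (s : Set α) ∪ Z))).card
              ≤ ((hclfin s).toFinset.powerset.image (fun t : Finset α => (t : Set α))).card :=
                Finset.card_image_le
            _ ≤ 2 ^ (M.closure (s : Set α) \ (s : Set α)).ncard := Matroid.card_powersetSets_le (hclfin s)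
            _ ≤ 2 ^ (B - q) := by
                apply Nat.pow_le_pow_right (by norm_num)
                have hsE : (s : Set α) ⊆ M.E := by rw [← hE]; exact Finset.coe_subset.2 hs.1
                have hr : M.eRk (M.closure (s : Set α)) ≤ q := by
                  rw [M.eRk_closure_eq]
                  calc M.eRk (s : Set α) ≤ (s : Set α).encard := M.eRk_le_encard _
                    _ = q := by rw [Set.encard_coe_eq_coe_finsetCard, hs.2]
                have hcl := hB (M.closure (s : Set α)) (M.closure_subset_ground _) hr
                have hsub : (s : Set α) ⊆ M.closure (s : Set α) := M.subset_closure _ hsE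
                have hclfin' : (M.closure (s : Set α)).Finite := M.ground_finite.subset (M.closure_subset_ground _)
                have hdiff : (M.closure (s : Set α) \ (s : Set α)).ncard + (s : Set α).ncard =
                    (M.closure (s : Set α)).ncard := Set.ncard_sdiff_add_ncard_of_subset hsub hclfin'
                have hsc : (s : Set α).ncard = q := by rw [Set.ncard_coe_finset, hs.2]
                omega
      _ = Ef.card.choose q * 2 ^ (B - q) := by
          rw [Finset.sum_const, smul_eq_mul, Finset.card_powersetCard]
  exact hS.trans hTfcard

/-- **The rank-`≤ q` count with a family of flat bounds**: if every set of rank `≤ j` has at most `B + j − q` points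
(`j ≤ q`; equivalently the excess `|X| − r` never exceeds `B − q`), then `#{X ⊆ E : r(X) ≤ q} ≤ (Σ_{j ≤ q} C(n, j))·2^{B − q}`. -/
theorem ncard_eRk_le_le_sum_choose_mul_of_bound (M : Matroid α) [M.Finite]
    (q B : ℕ) (hBj : ∀ j, j ≤ q → ∀ X ⊆ M.E, M.eRk X ≤ j → X.ncard + q ≤ B + j) :
    {X : Set α | X ⊆ M.E ∧ M.eRk X ≤ q}.ncard ≤
      (∑ j ∈ Finset.range (q + 1), M.ground_finite.toFinset.card.choose j) * 2 ^ (B - q) := by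
  have hfin : ∀ P : Set α → Prop, {X : Set α | X ⊆ M.E ∧ P X}.Finite :=
    fun P => M.ground_finite.finite_subsets.subset (fun X hX => hX.1)
  have hj : ∀ j, j ≤ q → {X : Set α | X ⊆ M.E ∧ M.eRk X = j}.ncard ≤
      M.ground_finite.toFinset.card.choose j * 2 ^ (B - q) := by
    intro j hjq
    have h := ncard_eRk_eq_le_choose_mul_of_bound M j (B + j - q) (fun X hX hr => by
      have := hBj j hjq X hX hr; omega)
    have he : B + j - q - j = B - q := by omega
    rw [he] at h
    exact h
  -- induction on `q'` ≤ `q` over the union of the rank-`j` layers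
  have key : ∀ q', q' ≤ q → {X : Set α | X ⊆ M.E ∧ M.eRk X ≤ q'}.ncard ≤
      (∑ j ∈ Finset.range (q' + 1), M.ground_finite.toFinset.card.choose j) * 2 ^ (B - q) := by
    intro q'
    induction q' with
    | zero =>
      intro _
      rw [Finset.sum_range_one]
      have hsub : {X : Set α | X ⊆ M.E ∧ M.eRk X ≤ ((0 : ℕ) : ℕ∞)} ⊆
          {X : Set α | X ⊆ M.E ∧ M.eRk X = ((0 : ℕ) : ℕ∞)} := by
        intro X hX
        exact ⟨hX.1, by simpa using hX.2⟩
      calc {X : Set α | X ⊆ M.E ∧ M.eRk X ≤ ((0 : ℕ) : ℕ∞)}.ncard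
          ≤ {X : Set α | X ⊆ M.E ∧ M.eRk X = ((0 : ℕ) : ℕ∞)}.ncard := Set.ncard_le_ncard hsub (hfin _)
        _ ≤ _ := hj 0 (by omega)
    | succ q' ih =>
      intro hq'
      rw [Finset.sum_range_succ, add_mul]
      have hsplit : {X : Set α | X ⊆ M.E ∧ M.eRk X ≤ ((q' + 1 : ℕ) : ℕ∞)} ⊆
          {X : Set α | X ⊆ M.E ∧ M.eRk X ≤ (q' : ℕ∞)} ∪
            {X : Set α | X ⊆ M.E ∧ M.eRk X = ((q' + 1 : ℕ) : ℕ∞)} := by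
        intro X hX
        rcases le_or_gt (M.eRk X) q' with h | h
        · exact Or.inl ⟨hX.1, h⟩
        · refine Or.inr ⟨hX.1, le_antisymm hX.2 ?_⟩
          rw [Nat.cast_succ]
          exact Order.add_one_le_of_lt h
      calc {X : Set α | X ⊆ M.E ∧ M.eRk X ≤ ((q' + 1 : ℕ) : ℕ∞)}.ncard
          ≤ ({X : Set α | X ⊆ M.E ∧ M.eRk X ≤ (q' : ℕ∞)} ∪
              {X : Set α | X ⊆ M.E ∧ M.eRk X = ((q' + 1 : ℕ) : ℕ∞)}).ncard :=
            Set.ncard_le_ncard hsplit ((hfin _).union (hfin _))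
        _ ≤ {X : Set α | X ⊆ M.E ∧ M.eRk X ≤ (q' : ℕ∞)}.ncard +
              {X : Set α | X ⊆ M.E ∧ M.eRk X = ((q' + 1 : ℕ) : ℕ∞)}.ncard := Set.ncard_union_le _ _
        _ ≤ (∑ j ∈ Finset.range (q' + 1), M.ground_finite.toFinset.card.choose j) * 2 ^ (B - q) +
              M.ground_finite.toFinset.card.choose (q' + 1) * 2 ^ (B - q) :=
            add_le_add (ih (by omega)) (hj (q' + 1) hq')
  exact key q le_rfl

/-- **THEOREM C∞, THE CORE, WITH AN ARBITRARY FLAT BOUND**: with `K = 2^{B − q}` from a family of flat bounds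
(`|X| + q ≤ B + j` for `r(X) ≤ j ≤ q`), thresholds `N₁` (`8(q+1)·K·n^q ≤ 2^n` for `n ≥ N₁`) and `P₂`
(`2^{p+q}·K·(2a + 1) ≤ 4^a`, `a = p − 1 − q`, for `p ≥ P₂`), every finite matroid of rank `p ≥ max N₁ P₂ (2^q + 2)`
with an `e`-free partition for every element and `|E| > p + q + B + 1` satisfies `Φ(p, q)·#U(p, q) ≤ #Y(p, q)`. -/
theorem core_all_corank_of_thresholds_of_bound (q B : ℕ) (hq : 2 ≤ q) (hqB : q ≤ B) (N₁ P₂ : ℕ)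
    (hN₁ : ∀ n, N₁ ≤ n → 8 * (q + 1) * 2 ^ (B - q) * n ^ q ≤ 2 ^ n)
    (hP₂ : ∀ p, P₂ ≤ p → 2 ^ (p + q) * 2 ^ (B - q) * (2 * (p - 1 - q) + 1) ≤ 4 ^ (p - 1 - q)) :
    ∀ {α : Type} (M : Matroid α) [M.Finite] (p : ℕ), max (max N₁ P₂) (2 ^ q + 2) ≤ p → M.eRank = (p : ℕ∞) →
      p + q + B + 1 < M.E.ncard →
      (∀ e ∈ M.E, ∃ A ⊆ M.E \ {e}, e ∉ M.closure A ∧ e ∉ M.closure ((M.E \ {e}) \ A)) →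
      (∀ j, j ≤ q → ∀ X ⊆ M.E, M.eRk X ≤ j → X.ncard + q ≤ B + j) → RLS M p q := by
  classical
  intro α M _ p hP hR hbig hfree hBj
  set n := M.E.ncard with hn_def
  have hEcard : M.ground_finite.toFinset.card = n := by
    rw [hn_def, Set.ncard_eq_toFinset_card _ M.ground_finite]
  have hq2 : 2 * q ≤ 2 ^ q := by
    have : q ≤ 2 ^ (q - 1) := by
      calc q = (q - 1) + 1 := by omega
        _ ≤ 2 ^ (q - 1) := Nat.lt_two_pow_self
    calc 2 * q ≤ 2 * 2 ^ (q - 1) := by omega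
      _ = 2 ^ (q - 1 + 1) := by ring
      _ = 2 ^ q := by congr 1; omega
  have hpP : 2 ^ q + 2 ≤ p := le_trans (le_max_right _ _) hP
  have hN₁p : N₁ ≤ p := le_trans (le_max_left _ _) (le_trans (le_max_left _ _) hP)
  have hP₂p : P₂ ≤ p := le_trans (le_max_right _ _) (le_trans (le_max_left _ _) hP)
  have hpn : p ≤ n := by omega
  have hBq' : ∀ X ⊆ M.E, M.eRk X ≤ q → X.ncard ≤ B := fun X hX hr => by
    have := hBj q le_rfl X hX hr; omega
  have hU : Matroid.topCount M p q ≤ n.choose q * 2 ^ (B - q) := by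
    calc Matroid.topCount M p q ≤ Matroid.levelCount M q := Matroid.topCount_le_levelCount_bot p q
      _ = {X : Set α | X ⊆ M.E ∧ M.eRk X = q}.ncard := rfl
      _ ≤ n.choose q * 2 ^ (B - q) := by rw [← hEcard]; exact ncard_eRk_eq_le_choose_mul_of_bound M q B hBq'
  have hΦ := phiK_le_two_pow_div p q
  have hU0 : (0 : ℚ) ≤ (Matroid.topCount M p q : ℚ) := by positivity
  have hUq : (Matroid.topCount M p q : ℚ) ≤ (n.choose q : ℚ) * 2 ^ (B - q) := by exact_mod_cast hU
  rw [RLS_iff]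
  rcases Nat.lt_or_ge n (2 * p) with hsmall | hlarge
  · have hd : M.E.encard = M.eRank + ((n - p : ℕ) : ℕ∞) := by
      rw [hR, ← M.ground_finite.cast_ncard_eq]
      norm_cast
      omega
    have hY := Matroid.two_pow_le_midCount_add (M := M) p q hR
    have hA := ncard_eRk_le_le_sum_choose_mul_of_bound M q B hBj
    have hB := Matroid.ncard_spanning_le (M := M) hd
    rw [hEcard] at hY hA hB
    have hA' : (∑ j ∈ Finset.range (q + 1), n.choose j) * 2 ^ (B - q) ≤ 2 ^ (n - 3) := by
      have h1 := sum_choose_le_mul_pow n q (by omega)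
      have h2 := hN₁ n (by omega)
      have h3 : 2 ^ n = 2 ^ (n - 3) * 8 := by
        rw [show (8 : ℕ) = 2 ^ 3 by norm_num, ← pow_add]; congr 1; omega
      have h5 : 8 * ((∑ j ∈ Finset.range (q + 1), n.choose j) * 2 ^ (B - q)) ≤ 8 * 2 ^ (n - 3) := by
        calc 8 * ((∑ j ∈ Finset.range (q + 1), n.choose j) * 2 ^ (B - q))
            ≤ 8 * (((q + 1) * n ^ q) * 2 ^ (B - q)) := by gcongr
          _ = 8 * (q + 1) * 2 ^ (B - q) * n ^ q := by ring
          _ ≤ 2 ^ n := h2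
          _ = 8 * 2 ^ (n - 3) := by rw [h3]; ring
      exact Nat.le_of_mul_le_mul_left h5 (by norm_num)
    have hB' : ∑ j ∈ Finset.range (n - p + 1), n.choose j ≤ 2 ^ (n - 1) :=
      sum_choose_le_two_pow_pred n (n - p) (by omega)
    have hCn : n.choose q ≤ 2 ^ q * (p + q).choose p := by
      rw [Nat.choose_symm_add]
      exact choose_le_two_pow_mul_choose n p q (by omega)
    have hYq : (2 : ℚ) ^ n ≤ (Matroid.midCount M p q : ℚ) + ({X : Set α | X ⊆ M.E ∧ M.eRk X ≤ q}.ncard : ℚ) +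
        ({X : Set α | X ⊆ M.E ∧ M.eRk X = M.eRank}.ncard : ℚ) := by exact_mod_cast hY
    have hAq : ({X : Set α | X ⊆ M.E ∧ M.eRk X ≤ q}.ncard : ℚ) ≤ 2 ^ (n - 3) := by
      exact_mod_cast hA.trans hA'
    have hBq2 : ({X : Set α | X ⊆ M.E ∧ M.eRk X = M.eRank}.ncard : ℚ) ≤ 2 ^ (n - 1) := by
      exact_mod_cast hB.trans hB'
    have hCnq : (n.choose q : ℚ) ≤ 2 ^ q * ((p + q).choose p : ℚ) := by exact_mod_cast hCn
    have hk : p + 2 * q + (B - q) + 2 ≤ n := by omega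
    exact coreSharper_arith_I hq hk hΦ hU0 hUq hCnq hYq hAq hBq2
  · have hY := choose_le_midCount_of_two_pow_le M hfree (p := p) (q := q) (by omega) (by omega)
    rw [hEcard] at hY
    have hkey := choose_mul_le_choose_mul_of_threshold n p q (2 ^ (B - q)) (by omega) hlarge (hP₂ p hP₂p)
    have hYq : (n.choose (p - 1) : ℚ) ≤ (Matroid.midCount M p q : ℚ) := by exact_mod_cast hY
    have hUq' : (Matroid.topCount M p q : ℚ) ≤ (n.choose q : ℚ) * ((2 ^ (B - q) : ℕ) : ℚ) := by
      exact_mod_cast hU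
    exact coreSharp_arith_II hΦ hU0 hUq' hkey hYq

/-- The family of flat bounds of the `e`-free core at `q = 4` with `B = 13` (the cover recursion: `f(4) ≤ 13`,
`f(j) ≤ 2^j − 1 ≤ 9 + j` below). -/
theorem flat_bounds_four_of_free (M : Matroid α) [M.Finite]
    (hfree : ∀ e ∈ M.E, ∃ A ⊆ M.E \ {e}, e ∉ M.closure A ∧ e ∉ M.closure ((M.E \ {e}) \ A)) :
    ∀ j : ℕ, j ≤ 4 → ∀ X ⊆ M.E, M.eRk X ≤ j → X.ncard + 4 ≤ 13 + j := by
  intro j hj X hX hr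
  rcases Nat.lt_or_ge j 4 with h | h
  · have := ncard_add_one_le_two_pow_of_eRk_le M (not_isLoop_of_free M hfree) hfree j X hX hr
    interval_cases j <;> omega
  · have hj4 : j = 4 := by omega
    subst hj4
    have := ncard_le_thirteen_of_eRk_le_four_of_free M hfree hX hr
    omega

/-- The family of flat bounds of the `e`-free core at `q = 5` with `B = 27`. -/
theorem flat_bounds_five_of_free (M : Matroid α) [M.Finite]
    (hfree : ∀ e ∈ M.E, ∃ A ⊆ M.E \ {e}, e ∉ M.closure A ∧ e ∉ M.closure ((M.E \ {e}) \ A)) :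
    ∀ j : ℕ, j ≤ 5 → ∀ X ⊆ M.E, M.eRk X ≤ j → X.ncard + 5 ≤ 27 + j := by
  intro j hj X hX hr
  rcases Nat.lt_or_ge j 5 with h | h
  · have := ncard_add_one_le_two_pow_of_eRk_le M (not_isLoop_of_free M hfree) hfree j X hX hr
    interval_cases j <;> omega
  · have hj5 : j = 5 := by omega
    subst hj5
    have := ncard_le_twentyseven_of_eRk_le_five_of_free M hfree hX hr
    omega

/-- **The core at `q = 4`, sharpest**: rank `p ≥ 35`, `e`-free partitions, `|E| ≥ p + 19` ⇒ C-025 at `(p, 4)`. -/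
theorem c025_core_four_sharpest (M : Matroid α) [M.Finite] (p : ℕ) (hp : 35 ≤ p) (hR : M.eRank = (p : ℕ∞))
    (hbig : p + 18 < M.E.ncard)
    (hfree : ∀ e ∈ M.E, ∃ A ⊆ M.E \ {e}, e ∉ M.closure A ∧ e ∉ M.closure ((M.E \ {e}) \ A)) : RLS M p 4 := by
  have hN₁ : ∀ n, 35 ≤ n → 8 * (4 + 1) * 2 ^ (13 - 4) * n ^ 4 ≤ 2 ^ n :=
    mul_pow_le_two_pow_of_base (8 * (4 + 1) * 2 ^ (13 - 4)) 4 35 (by norm_num) (by norm_num) (by norm_num)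
  have hP₂ := threshold_II_of_base 4 (2 ^ (13 - 4)) 29 (by norm_num) (by norm_num)
  have hmax : max (max 35 29) (2 ^ 4 + 2) = 35 := by decide
  refine core_all_corank_of_thresholds_of_bound 4 13 (by norm_num) (by norm_num) 35 29 hN₁ hP₂ M p
    (by rw [hmax]; exact hp) hR (by omega) hfree (flat_bounds_four_of_free M hfree)

/-- **The core at `q = 5`, sharpest**: rank `p ≥ 57`, `e`-free partitions, `|E| ≥ p + 34` ⇒ C-025 at `(p, 5)`. -/
theorem c025_core_five_sharpest (M : Matroid α) [M.Finite] (p : ℕ) (hp : 57 ≤ p) (hR : M.eRank = (p : ℕ∞))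
    (hbig : p + 33 < M.E.ncard)
    (hfree : ∀ e ∈ M.E, ∃ A ⊆ M.E \ {e}, e ∉ M.closure A ∧ e ∉ M.closure ((M.E \ {e}) \ A)) : RLS M p 5 := by
  have hN₁ : ∀ n, 57 ≤ n → 8 * (5 + 1) * 2 ^ (27 - 5) * n ^ 5 ≤ 2 ^ n :=
    mul_pow_le_two_pow_of_base (8 * (5 + 1) * 2 ^ (27 - 5)) 5 57 (by norm_num) (by norm_num) (by norm_num)
  have hP₂ := threshold_II_of_base 5 (2 ^ (27 - 5)) 46 (by norm_num) (by norm_num)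
  have hmax : max (max 57 46) (2 ^ 5 + 2) = 57 := by decide
  refine core_all_corank_of_thresholds_of_bound 5 27 (by norm_num) (by norm_num) 57 46 hN₁ hP₂ M p
    (by rw [hmax]; exact hp) hR (by omega) hfree (flat_bounds_five_of_free M hfree)

/-- **The core at `q = 4` under C-030's flat bound `f(4) ≤ 10`** (a hypothesis here — p2's `card_le_ten_of_core` for
the coloop-free `Core`, to be transferred by `RankLevelSetDeleteColoops`): rank `p ≥ 32`, `e`-free partitions,
`|E| ≥ p + 16` ⇒ C-025 at `(p, 4)`. -/
theorem c025_core_four_of_flat_ten (M : Matroid α) [M.Finite] (p : ℕ) (hp : 32 ≤ p) (hR : M.eRank = (p : ℕ∞))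
    (hbig : p + 15 < M.E.ncard)
    (hfree : ∀ e ∈ M.E, ∃ A ⊆ M.E \ {e}, e ∉ M.closure A ∧ e ∉ M.closure ((M.E \ {e}) \ A))
    (hten : ∀ X ⊆ M.E, M.eRk X ≤ 4 → X.ncard ≤ 10) : RLS M p 4 := by
  have hN₁ : ∀ n, 32 ≤ n → 8 * (4 + 1) * 2 ^ (10 - 4) * n ^ 4 ≤ 2 ^ n :=
    mul_pow_le_two_pow_of_base (8 * (4 + 1) * 2 ^ (10 - 4)) 4 32 (by norm_num) (by norm_num) (by norm_num)
  have hP₂ := threshold_II_of_base 4 (2 ^ (10 - 4)) 26 (by norm_num) (by norm_num)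
  have hmax : max (max 32 26) (2 ^ 4 + 2) = 32 := by decide
  have hBj : ∀ j : ℕ, j ≤ 4 → ∀ X ⊆ M.E, M.eRk X ≤ j → X.ncard + 4 ≤ 10 + j := by
    intro j hj X hX hr
    rcases Nat.lt_or_ge j 4 with h | h
    · have := ncard_add_one_le_two_pow_of_eRk_le M (not_isLoop_of_free M hfree) hfree j X hX hr
      interval_cases j <;> omega
    · have hj4 : j = 4 := by omega
      subst hj4
      have := hten X hX hr
      omega
  exact core_all_corank_of_thresholds_of_bound 4 10 (by norm_num) (by norm_num) 32 26 hN₁ hP₂ M p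
    (by rw [hmax]; exact hp) hR (by omega) hfree hBj

/-- **The core at `q = 5` under C-030's flat bounds `f(4) ≤ 10`, `f(5) ≤ 15`** (hypotheses here): rank `p ≥ 43`,
`e`-free partitions, `|E| ≥ p + 22` ⇒ C-025 at `(p, 5)`. -/
theorem c025_core_five_of_flat_fifteen (M : Matroid α) [M.Finite] (p : ℕ) (hp : 43 ≤ p) (hR : M.eRank = (p : ℕ∞))
    (hbig : p + 21 < M.E.ncard)
    (hfree : ∀ e ∈ M.E, ∃ A ⊆ M.E \ {e}, e ∉ M.closure A ∧ e ∉ M.closure ((M.E \ {e}) \ A))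
    (hten : ∀ X ⊆ M.E, M.eRk X ≤ 4 → X.ncard ≤ 10) (hfifteen : ∀ X ⊆ M.E, M.eRk X ≤ 5 → X.ncard ≤ 15) :
    RLS M p 5 := by
  have hN₁ : ∀ n, 43 ≤ n → 8 * (5 + 1) * 2 ^ (15 - 5) * n ^ 5 ≤ 2 ^ n :=
    mul_pow_le_two_pow_of_base (8 * (5 + 1) * 2 ^ (15 - 5)) 5 43 (by norm_num) (by norm_num) (by norm_num)
  have hP₂ := threshold_II_of_base 5 (2 ^ (15 - 5)) 33 (by norm_num) (by norm_num)
  have hmax : max (max 43 33) (2 ^ 5 + 2) = 43 := by decide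
  have hBj : ∀ j : ℕ, j ≤ 5 → ∀ X ⊆ M.E, M.eRk X ≤ j → X.ncard + 5 ≤ 15 + j := by
    intro j hj X hX hr
    rcases Nat.lt_or_ge j 4 with h | h
    · have := ncard_add_one_le_two_pow_of_eRk_le M (not_isLoop_of_free M hfree) hfree j X hX hr
      interval_cases j <;> omega
    · rcases Nat.lt_or_ge j 5 with h5 | h5
      · have hj4 : j = 4 := by omega
        subst hj4
        have := hten X hX hr
        omega
      · have hj5 : j = 5 := by omega
        subst hj5
        have := hfifteen X hX hr
        omega
  exact core_all_corank_of_thresholds_of_bound 5 15 (by norm_num) (by norm_num) 43 33 hN₁ hP₂ M p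
    (by rw [hmax]; exact hp) hR (by omega) hfree hBj

end ThmN

end PercRepro
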